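import Summits.QuantumAdvantage.QuantumAdvantage.Theorems.CubicForrelationNearExactIsExactTwelveLevelFiveSign
import Summits.QuantumAdvantage.QuantumAdvantage.Theorems.CubicForrelationNearExactIsExactTwelveLevelSixWindowDead

/-!
# Crux `CubicForrelation.NearExactIsExact` (stmt-QuantumAdvantage-14043) — n = 12: a GENERIC level-5 side (`4 ∣ e₅` off the odd hyperplane,
  `8 ∣ e₅ − σ₅` on it) is impossible on the OPEN window `57/64 < Φ < 29/32`, whatever the partner

Certificate seat `b2b-cforr-cert` (gen 27).  HONEST FRAMING: a kernel-checked finite-slice theorem (standard axioms) about cubic Boolean pairs on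
12 bits; it removes the "generic" configuration of a level-5 side from the open window (gens 20–23 removed it only at `Φ ≥ 29/32` and under the
hypothesis that the pair is exact off the hyperplane).  What is left for a level-5 side on the window (`tzl5_window_structure`): off-hyperplane
energy `≥ 1024` (an off-`P` point with `4 ∤ e₅`, hence `≥ 256` of them), or a point of `P` with `e₅ ≢ σ₅ (mod 8)` (the "rigid" world).
NO value of `θ₁₂` claimed (`θ₁₂ ∈ [57/64, 14847/16384]`); NOT summit progress.

THE ARGUMENT (`tzl5_generic_window_false`).  `W_g = 32u'`, `P = {u' odd} = x₀ ⊕ V`, `e₅ = u' − 2(−1)^f`, `S₅ = σ₅·1_P`, `q := (e₅ − S₅)²`,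
`c := e₅² − 1_P`, `Σc = 32768(1 − Φ) − 2048 ≤ 1535`.  Generic hypotheses give `64 ∣ q` and `4c ≥ 3q` on `P` (`e₅ = σ₅ + 8m`), `q = c = e₅² ∈ 16ℤ`
off `P`; hence (`tzl5_generic_pi_bound`) `Σq ≤ 2029` (else `3Q_P + 4E ≤ 6140 < 3Q_P + 3E + …` with `64 ∣ Q_P`, `16 ∣ E`).  By …TwelveLevelFiveSign the
sign character sum `M` vanishes off `≤ 8` frequencies; the duality `ê₅ = 128(−1)^g − 2W_f` (`tzl5_ehat`) and Parseval give
`Σ_y (128(−1)^g − 2W_f − M)² = 4096·Σq ≤ 4096·2029`.  A TYPE-O partner (`2W_f = 32u_f`, `u_f` odd, `≡ ±1 (mod 8)` on `≥ 512` points) makes the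
left side `≥ 1024·4088 + 8192·504 = 4096·2030`; a LEVEL-5 partner (`2W_f = 64u′_f`, `u′_f` odd on `≥ 2048` points) makes it `≥ 4096·2040`; a
level-`≥ 6` partner is excluded by `tz_levelSix_window_false` (gen 27).  Contradiction in all cases.

References: MacWilliams–Sloane (1977) Ch. 13–15; R. O'Donnell (2014) §1.4, §3.3.  Axioms: the standard three.
-/

set_option linter.dupNamespace false -- D-0017: single-problem summit ⇒ `QuantumAdvantage.QuantumAdvantage` by design

noncomputable section

namespace Summit.QuantumAdvantage.QuantumAdvantage.Theorems.CubicForrelation.NearExactIsExact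

open Finset
open Literature.Computability.QuantumComplexity
open Literature.Computability.QuantumComplexity.BuzetChailloux (bxor zeroVec bxor_bxor_cancel_left bxor_zeroVec zeroVec_bxor bxor_comm
  bxor_self)
open Literature.Computability.QuantumComplexity.DerivativeWalsh (W sum_W_sq)
open Summit.QuantumAdvantage.QuantumAdvantage.Theorems.NearExactIsExact.Negative (TypeOTwelve.typeO_of_exists_odd)

/-- **`ê₅(y) = 128(−1)^{g(y)} − 2W_f(y)`** for `W_g = 32u'` and ANY Boolean `f` (Walsh inversion). [folklore] -/
theorem tzl5_ehat (f g : (Fin (6 + 6) → Bool) → Bool)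
    (u' : (Fin (6 + 6) → Bool) → ℤ) (hu' : ∀ x, W (fun y => signOf (g y)) x = (2 : ℝ) ^ 5 * (u' x : ℝ)) (y : Fin (6 + 6) → Bool) :
    ∑ a, (((u' a - 2 * sZ (f a) : ℤ)) : ℝ) * twist a y = 128 * signOf (g y) - 2 * W (fun x => signOf (f x)) y := by
  have hinv := tz_inversion (fun t => signOf (g t)) y
  have h1 : ∑ a, ((u' a : ℤ) : ℝ) * twist a y = 128 * signOf (g y) := by
    have h' : ∑ a, ((u' a : ℤ) : ℝ) * twist a y = (∑ a, W (fun t => signOf (g t)) a * twist a y) / 2 ^ 5 := by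
      rw [eq_div_iff (by norm_num), sum_mul]
      exact sum_congr rfl fun a _ => by rw [hu' a]; ring
    rw [h', hinv]; norm_num; ring
  have h2 : ∑ a, (((u' a - 2 * sZ (f a) : ℤ)) : ℝ) * twist a y = ∑ a, ((u' a : ℤ) : ℝ) * twist a y - 2 * ∑ a, signOf (f a) * twist a y := by
    rw [mul_sum, ← sum_sub_distrib]; exact sum_congr rfl fun a _ => by push_cast; rw [tp_sZ_cast]; ring
  rw [h2, h1]
  rfl

/-- **The perturbation bound for a generic level-5 side**: cubic `f, g`, `W_g = 32u'`, `P = {u' odd} = x₀ ⊕ V`, `57/64 < Φ`, `4 ∣ e₅` off `P`,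
`8 ∣ e₅ − σ₅` on `P` ⇒ `Σ_x (e₅ − σ₅1_P)² ≤ 2029`.  Finite-slice statement, NOT summit progress. [this work] -/
theorem tzl5_generic_pi_bound (f g : (Fin (6 + 6) → Bool) → Bool)
    (u' : (Fin (6 + 6) → Bool) → ℤ) (hu' : ∀ x, W (fun y => signOf (g y)) x = (2 : ℝ) ^ 5 * (u' x : ℝ))
    (V : Finset (Fin (6 + 6) → Bool)) (x₀ : Fin (6 + 6) → Bool)
    (hcardV : #V = 2048) (hP : (univ.filter fun x : Fin (6 + 6) → Bool => Odd (u' x)) = V.image (bxor x₀))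
    (hlo : (57 / 64 : ℝ) < forrelation f g)
    (h4off : ∀ y, ¬ Odd (u' y) → (4 : ℤ) ∣ u' y - 2 * sZ (f y))
    (h8on : ∀ x, Odd (u' x) → (8 : ℤ) ∣ u' x - 2 * sZ (f x) - sZ (decide ((u' x - 2 * sZ (f x)) % 4 = 3))) :
    (∑ x, (u' x - 2 * sZ (f x) - (if Odd (u' x) then sZ (decide ((u' x - 2 * sZ (f x)) % 4 = 3)) else 0)) ^ 2 : ℤ) ≤ 2029 := by
  classical
  set P := univ.filter (fun x : Fin (6 + 6) → Bool => Odd (u' x)) with hPdef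
  set e : (Fin (6 + 6) → Bool) → ℤ := fun x => u' x - 2 * sZ (f x) with hedef
  set hb : (Fin (6 + 6) → Bool) → Bool := fun x => decide (e x % 4 = 3) with hbdef
  have hmemP : ∀ x, x ∈ P ↔ Odd (u' x) := fun x => by simp [hPdef]
  have hPcard : #P = 2048 := by rw [hP, card_image_of_injective _ (iw_bxor_injective x₀), hcardV]
  -- budget `Σ e₅² = 32768(1 − Φ) < 3584`
  set u : (Fin (6 + 6) → Bool) → ℤ := fun x => 2 * u' x with hudef
  have hu : ∀ x, W (fun y => signOf (g y)) x = (2 : ℝ) ^ 4 * (u x : ℝ) := by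
    intro x; rw [hu' x]; simp only [u]; push_cast; ring
  have hbud := tw12_budget f g u hu
  have h4e : ∀ x, (u x - 4 * sZ (f x)) ^ 2 = 4 * e x ^ 2 := fun x => by simp only [u, e]; ring
  have hBR : ((∑ x, e x ^ 2 : ℤ) : ℝ) = 32768 * (1 - forrelation f g) := by
    have h' : ((∑ x, (u x - 4 * sZ (f x)) ^ 2 : ℤ) : ℝ) = 4 * ((∑ x, e x ^ 2 : ℤ) : ℝ) := by
      rw [sum_congr rfl fun x _ => h4e x, ← mul_sum]; push_cast; ring
    rw [h'] at hbud
    linarith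
  have hB : (∑ x, e x ^ 2 : ℤ) ≤ 3583 := by
    have h' : ((∑ x, e x ^ 2 : ℤ) : ℝ) < 3584 := by rw [hBR]; linarith
    have h'' : (∑ x, e x ^ 2 : ℤ) < 3584 := by exact_mod_cast h'
    omega
  -- pointwise facts
  have heodd : ∀ x ∈ P, Odd (e x) := fun x hx => Int.odd_sub.2 (iff_of_true ((hmemP x).1 hx) ⟨sZ (f x), two_mul _⟩)
  set q : (Fin (6 + 6) → Bool) → ℤ := fun x => (e x - (if Odd (u' x) then sZ (hb x) else 0)) ^ 2 with hqdef
  set c : (Fin (6 + 6) → Bool) → ℤ := fun x => e x ^ 2 - (if x ∈ P then 1 else 0) with hcdef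
  show ∑ x, q x ≤ 2029
  have hsplit : ∀ F : (Fin (6 + 6) → Bool) → ℤ, ∑ x, F x = ∑ x ∈ P, F x + ∑ x ∈ univ.filter (fun x => x ∉ P), F x := by
    intro F
    rw [← sum_filter_add_sum_filter_not univ (fun x => x ∈ P)]
    congr 1
    exact sum_congr (by ext x; simp) fun _ _ => rfl
  have hqon : ∀ x ∈ P, q x = (e x - sZ (hb x)) ^ 2 := fun x hx => by simp only [q]; rw [if_pos ((hmemP x).1 hx)]
  have hqoff : ∀ x, x ∉ P → q x = e x ^ 2 := fun x hx => by
    simp only [q]; rw [if_neg (fun h => hx ((hmemP x).2 h)), sub_zero]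
  have hcon : ∀ x ∈ P, c x = e x ^ 2 - 1 := fun x hx => by simp only [c]; rw [if_pos hx]
  have hcoff : ∀ x, x ∉ P → c x = e x ^ 2 := fun x hx => by simp only [c]; rw [if_neg hx, sub_zero]
  -- on `P`: `64 ∣ q` and `3q ≤ 4c`
  have h64 : ∀ x ∈ P, (64 : ℤ) ∣ q x := by
    intro x hx
    obtain ⟨k, hk⟩ := h8on x ((hmemP x).1 hx)
    rw [hqon x hx]
    exact ⟨k ^ 2, by rw [show e x - sZ (hb x) = 8 * k from hk]; ring⟩
  have h34 : ∀ x ∈ P, 3 * q x ≤ 4 * c x := by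
    intro x hx
    rw [hqon x hx, hcon x hx]
    exact tzc_pw_three (tp_sZ_cases (hb x)) (h8on x ((hmemP x).1 hx))
  -- off `P`: `16 ∣ q = c`
  have h16 : ∀ x, x ∉ P → (16 : ℤ) ∣ q x := by
    intro x hx
    obtain ⟨k, hk⟩ := h4off x (fun h => hx ((hmemP x).2 h))
    rw [hqoff x hx]
    exact ⟨k ^ 2, by rw [show e x = 4 * k from hk]; ring⟩
  -- sums
  have hindP : ∑ x, (if x ∈ P then (1 : ℤ) else 0) = 2048 := by
    rw [sum_boole]
    have : (univ.filter fun x => x ∈ P) = P := by ext x; simp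
    rw [this, hPcard]; norm_num
  have hcsum : ∑ x, c x ≤ 1535 := by
    have : ∑ x, c x = (∑ x, e x ^ 2) - 2048 := by simp only [c]; rw [sum_sub_distrib, hindP]
    omega
  set QP := ∑ x ∈ P, q x with hQP
  set E := ∑ x ∈ univ.filter (fun x => x ∉ P), q x with hE
  have hQPdvd : (64 : ℤ) ∣ QP := dvd_sum fun x hx => h64 x hx
  have hEdvd : (16 : ℤ) ∣ E := dvd_sum fun x hx => h16 x (mem_filter.1 hx).2
  have hEnn : 0 ≤ E := sum_nonneg fun x _ => by simp only [q]; exact sq_nonneg _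
  have hQPnn : 0 ≤ QP := sum_nonneg fun x _ => by simp only [q]; exact sq_nonneg _
  have hcE : ∑ x ∈ univ.filter (fun x => x ∉ P), c x = E :=
    sum_congr rfl fun x hx => by rw [hcoff x (mem_filter.1 hx).2, hqoff x (mem_filter.1 hx).2]
  have hcP : 3 * QP ≤ 4 * ∑ x ∈ P, c x := by
    rw [hQP, mul_sum, mul_sum]; exact sum_le_sum h34
  have hmain : 3 * QP + 4 * E ≤ 6140 := by
    have h := hcsum
    rw [hsplit c, hcE] at h
    linarith
  rw [hsplit q]
  change QP + E ≤ 2029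
  omega

/-- **A generic level-5 side is impossible on the open window** (module docstring): cubic `f, g` on 12 bits, `W_g = 32u'` with some `u'` odd,
`57/64 < Φ(f,g) < 1`, `4 ∣ u' − 2(−1)^f` off the odd set and `8 ∣ u' − 2(−1)^f − σ₅` on it ⇒ `False`.  Finite-slice statement, NOT summit
progress. [this work] -/
theorem tzl5_generic_window_false (f g : (Fin (6 + 6) → Bool) → Bool) (hf : IsDegLeFun 3 f) (hg : IsDegLeFun 3 g)
    (u' : (Fin (6 + 6) → Bool) → ℤ) (hu' : ∀ x, W (fun y => signOf (g y)) x = (2 : ℝ) ^ 5 * (u' x : ℝ)) (hodd : ∃ x, Odd (u' x))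
    (hlo : (57 / 64 : ℝ) < forrelation f g) (hhi : forrelation f g < 1)
    (h4off : ∀ y, ¬ Odd (u' y) → (4 : ℤ) ∣ u' y - 2 * sZ (f y))
    (h8on : ∀ x, Odd (u' x) → (8 : ℤ) ∣ u' x - 2 * sZ (f x) - sZ (decide ((u' x - 2 * sZ (f x)) % 4 = 3))) : False := by
  classical
  set P := univ.filter (fun x : Fin (6 + 6) → Bool => Odd (u' x)) with hPdef
  set e : (Fin (6 + 6) → Bool) → ℤ := fun x => u' x - 2 * sZ (f x) with hedef
  set hb : (Fin (6 + 6) → Bool) → Bool := fun x => decide (e x % 4 = 3) with hbdef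
  have hmemP : ∀ x, x ∈ P ↔ Odd (u' x) := fun x => by simp [hPdef]
  -- budget and the hyperplane
  set u : (Fin (6 + 6) → Bool) → ℤ := fun x => 2 * u' x with hudef
  have hu : ∀ x, W (fun y => signOf (g y)) x = (2 : ℝ) ^ 4 * (u x : ℝ) := by
    intro x; rw [hu' x]; simp only [u]; push_cast; ring
  have hbud := tw12_budget f g u hu
  have h4e : ∀ x, (u x - 4 * sZ (f x)) ^ 2 = 4 * e x ^ 2 := fun x => by simp only [u, e]; ring
  have hBR : ((∑ x, e x ^ 2 : ℤ) : ℝ) = 32768 * (1 - forrelation f g) := by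
    have h' : ((∑ x, (u x - 4 * sZ (f x)) ^ 2 : ℤ) : ℝ) = 4 * ((∑ x, e x ^ 2 : ℤ) : ℝ) := by
      rw [sum_congr rfl fun x _ => h4e x, ← mul_sum]; push_cast; ring
    rw [h'] at hbud
    linarith
  have hB : (∑ x, e x ^ 2 : ℤ) ≤ 3583 := by
    have h' : ((∑ x, e x ^ 2 : ℤ) : ℝ) < 3584 := by rw [hBR]; linarith
    have h'' : (∑ x, e x ^ 2 : ℤ) < 3584 := by exact_mod_cast h'
    omega
  have heodd : ∀ x, Odd (u' x) → Odd (e x) := fun x hx => Int.odd_sub.2 (iff_of_true hx ⟨sZ (f x), two_mul _⟩)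
  have hev : ∃ x, ¬ Odd (u' x) := by
    by_contra hall
    push Not at hall
    have hge : ∀ x, (1 : ℤ) ≤ e x ^ 2 := fun x => by
      have h0 := Int.odd_iff.1 (heodd x (hall x))
      have : e x ≤ -1 ∨ 1 ≤ e x := by omega
      have := tp_sq_ge (k := 1) (by norm_num) this
      linarith
    have h := sum_le_sum fun x (_ : x ∈ (univ : Finset (Fin (6 + 6) → Bool))) => hge x
    rw [sum_const, card_univ, Fintype.card_fun, Fintype.card_bool, Fintype.card_fin] at h
    norm_num at h
    linarith
  obtain ⟨V, x₀, h0, hadd, hcardV, hP⟩ := tzl5_hyperplane g hg u' hu' hodd hev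
  have hPcard : #P = 2048 := by rw [hPdef, hP, card_image_of_injective _ (iw_bxor_injective x₀), hcardV]
  have hsplit : ∀ F : (Fin (6 + 6) → Bool) → ℤ, ∑ x, F x = ∑ x ∈ P, F x + ∑ x ∈ univ.filter (fun x => x ∉ P), F x := by
    intro F
    rw [← sum_filter_add_sum_filter_not univ (fun x => x ∈ P)]
    congr 1
    exact sum_congr (by ext x; simp) fun _ _ => rfl
  have hoff : ∑ y ∈ univ.filter (fun y : Fin (6 + 6) → Bool => ¬ Odd (u' y)), e y ^ 2 ≤ 2047 := by
    have hge : ∀ x ∈ P, (1 : ℤ) ≤ e x ^ 2 := fun x hx => by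
      have h0 := Int.odd_iff.1 (heodd x ((hmemP x).1 hx))
      have : e x ≤ -1 ∨ 1 ≤ e x := by omega
      have := tp_sq_ge (k := 1) (by norm_num) this
      linarith
    have hPsum : (2048 : ℤ) ≤ ∑ x ∈ P, e x ^ 2 := by
      have h := sum_le_sum hge
      rw [sum_const, hPcard, nsmul_eq_mul] at h
      norm_num at h
      exact h
    have e1 : univ.filter (fun x => x ∉ P) = univ.filter (fun y : Fin (6 + 6) → Bool => ¬ Odd (u' y)) := by
      ext x; simp [hmemP]
    have h := hB
    rw [hsplit, e1] at h
    linarith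
  -- the sign character sums
  obtain ⟨hMv, hMsupp⟩ := tzl5_M_struct f g hf hg u' hu' V x₀ h0 hadd hcardV hP h4off hoff h8on
  set M : (Fin (6 + 6) → Bool) → ℝ := fun y => ∑ x ∈ P, signOf (hb x) * twist x y with hMdef
  have hindM : ∑ y, (if M y ≠ 0 then (1 : ℝ) else 0) ≤ 8 := by
    rw [sum_boole]; exact_mod_cast hMsupp
  -- the bridge: `Σ_y (128 s_g − 2W_f − M)² = 4096 Σ q ≤ 4096·2029`
  set S : (Fin (6 + 6) → Bool) → ℤ := fun x => if Odd (u' x) then sZ (hb x) else 0 with hSdef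
  have hpi : (∑ x, (e x - S x) ^ 2 : ℤ) ≤ 2029 := tzl5_generic_pi_bound f g u' hu' V x₀ hcardV hP hlo h4off h8on
  have hShat : ∀ y, ∑ a, ((S a : ℤ) : ℝ) * twist a y = M y := by
    intro y
    have hres : ∑ a, ((S a : ℤ) : ℝ) * twist a y = ∑ a ∈ P, ((S a : ℤ) : ℝ) * twist a y := by
      symm
      apply sum_subset (subset_univ P)
      intro x _ hx
      simp only [S]; rw [if_neg (fun h => hx ((hmemP x).2 h))]; simp
    rw [hres]
    exact sum_congr rfl fun x hx => by simp only [S]; rw [if_pos ((hmemP x).1 hx), tp_sZ_cast]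
  have hW : ∀ y, W (fun a => (((e a - S a : ℤ)) : ℝ)) y = 128 * signOf (g y) - 2 * W (fun x => signOf (f x)) y - M y := by
    intro y
    show ∑ a, (((e a - S a : ℤ)) : ℝ) * twist a y = _
    have h1 : ∑ a, (((e a - S a : ℤ)) : ℝ) * twist a y = ∑ a, ((e a : ℤ) : ℝ) * twist a y - ∑ a, ((S a : ℤ) : ℝ) * twist a y := by
      rw [← sum_sub_distrib]; exact sum_congr rfl fun x _ => by push_cast; ring
    rw [h1, hShat y]
    have h2 : ∑ a, ((e a : ℤ) : ℝ) * twist a y = 128 * signOf (g y) - 2 * W (fun x => signOf (f x)) y := tzl5_ehat f g u' hu' y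
    rw [h2]
  have hbridge : ∑ y, (128 * signOf (g y) - 2 * W (fun x => signOf (f x)) y - M y) ^ 2 ≤ 4096 * 2029 := by
    have hP2 := sum_W_sq (fun a => (((e a - S a : ℤ)) : ℝ))
    simp_rw [hW] at hP2
    rw [hP2]
    have h1 : ∑ x, ((((e x - S x : ℤ)) : ℝ)) ^ 2 = ((∑ x, (e x - S x) ^ 2 : ℤ) : ℝ) := by push_cast; rfl
    have h2 : ((∑ x, (e x - S x) ^ 2 : ℤ) : ℝ) ≤ 2029 := by exact_mod_cast hpi
    rw [h1, show ((2 : ℝ) ^ (6 + 6)) = 4096 by norm_num]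
    linarith
  -- the partner
  obtain ⟨u₄, hu₄⟩ := tw_base (n := 6 + 6) f hf 4 (by norm_num)
  have hcase5 : (∀ y, ¬ Odd (u₄ y)) → ∀ y, W (fun x => signOf (f x)) y = (2 : ℝ) ^ 5 * (((u₄ y / 2 : ℤ)) : ℝ) :=
    fun hevf y => (tw_level_up (j := 4) f u₄ hu₄ hevf y).trans (by norm_num)
  have hcase6 : (∀ y, ¬ Odd (u₄ y)) → (∀ y, ¬ Odd (u₄ y / 2)) → ∀ y, W (fun x => signOf (f x)) y = (2 : ℝ) ^ 6 * (((u₄ y / 2 / 2 : ℤ)) : ℝ) :=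
    fun hevf hevf' y => (tw_level_up (j := 5) f (fun y => u₄ y / 2) (hcase5 hevf) hevf' y).trans (by norm_num)
  by_cases hO : ∃ y, Odd (u₄ y)
  · -- type-O partner
    obtain ⟨hall, hEcard⟩ := tzp_typeO_struct f hf u₄ hu₄ hO
    set Ef := univ.filter (fun y : Fin (6 + 6) → Bool => u₄ y % 8 = 1 ∨ u₄ y % 8 = 7) with hEfdef
    have hpt : ∀ y, (1024 : ℝ) + 8192 * (if y ∈ Ef then (1 : ℝ) else 0) - 9216 * (if M y ≠ 0 then (1 : ℝ) else 0) ≤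
        (128 * signOf (g y) - 2 * W (fun x => signOf (f x)) y - M y) ^ 2 := by
      intro y
      have hint := tzp_typeO_pt (u₄ y) (sZ (g y)) 0 (hall y) (tp_sZ_cases (g y))
      by_cases hMy : M y = 0
      · rw [if_neg (not_not.2 hMy), hMy, hu₄ y, ← tp_sZ_cast (g y)]
        have e1 : (128 * ((sZ (g y) : ℤ) : ℝ) - 2 * ((2 : ℝ) ^ 4 * (u₄ y : ℝ)) - 0) ^ 2 =
            4 * (((64 * sZ (g y) - 16 * u₄ y - 128 * 0) ^ 2 : ℤ) : ℝ) := by push_cast; ring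
        rw [e1]
        by_cases hyE : y ∈ Ef
        · rw [if_pos hyE]
          have h9 := hint.2 (mem_filter.1 hyE).2 rfl
          have : ((2304 : ℤ) : ℝ) ≤ (((64 * sZ (g y) - 16 * u₄ y - 128 * 0) ^ 2 : ℤ) : ℝ) := by exact_mod_cast h9
          norm_num at this ⊢; linarith
        · rw [if_neg hyE]
          have : ((256 : ℤ) : ℝ) ≤ (((64 * sZ (g y) - 16 * u₄ y - 128 * 0) ^ 2 : ℤ) : ℝ) := by exact_mod_cast hint.1
          norm_num at this ⊢; linarith
      · rw [if_pos hMy]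
        have h1 : (if y ∈ Ef then (1 : ℝ) else 0) ≤ 1 := by split_ifs <;> norm_num
        nlinarith [sq_nonneg (128 * signOf (g y) - 2 * W (fun x => signOf (f x)) y - M y)]
    have hsum := sum_le_sum fun y (_ : y ∈ (univ : Finset (Fin (6 + 6) → Bool))) => hpt y
    have hindE : ∑ y, (if y ∈ Ef then (1 : ℝ) else 0) = #Ef := by
      rw [sum_boole]
      have : (univ.filter fun y => y ∈ Ef) = Ef := by ext y; simp
      rw [this]
    have hconst : ∑ _y : Fin (6 + 6) → Bool, (1024 : ℝ) = 4194304 := by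
      rw [sum_const, card_univ, Fintype.card_fun, Fintype.card_bool, Fintype.card_fin, nsmul_eq_mul]; norm_num
    rw [sum_sub_distrib, sum_add_distrib, ← mul_sum, ← mul_sum, hindE, hconst] at hsum
    have hE' : (512 : ℝ) ≤ #Ef := by exact_mod_cast hEcard
    nlinarith
  · push Not at hO
    have hu₅ := hcase5 hO
    by_cases h5 : ∃ y, Odd (u₄ y / 2)
    · -- level-5 partner
      have hP'card := tzp_levelFive_card f hf (fun y => u₄ y / 2) hu₅ h5
      set P' := univ.filter (fun y : Fin (6 + 6) → Bool => Odd (u₄ y / 2)) with hP'def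
      have hpt : ∀ y, (4096 : ℝ) * (if y ∈ P' then (1 : ℝ) else 0) - 4096 * (if M y ≠ 0 then (1 : ℝ) else 0) ≤
          (128 * signOf (g y) - 2 * W (fun x => signOf (f x)) y - M y) ^ 2 := by
        intro y
        by_cases hMy : M y = 0
        · rw [if_neg (not_not.2 hMy), hMy, hu₅ y, ← tp_sZ_cast (g y)]
          have e1 : (128 * ((sZ (g y) : ℤ) : ℝ) - 2 * ((2 : ℝ) ^ 5 * (((u₄ y / 2 : ℤ)) : ℝ)) - 0) ^ 2 =
              4 * (((64 * sZ (g y) - 32 * (u₄ y / 2) - 128 * 0) ^ 2 : ℤ) : ℝ) := by push_cast; ring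
          rw [e1]
          by_cases hyP : y ∈ P'
          · rw [if_pos hyP]
            have h1 := tzp_levelFive_pt (u₄ y / 2) (sZ (g y)) 0 (mem_filter.1 hyP).2 (tp_sZ_cases (g y))
            have : ((1024 : ℤ) : ℝ) ≤ (((64 * sZ (g y) - 32 * (u₄ y / 2) - 128 * 0) ^ 2 : ℤ) : ℝ) := by exact_mod_cast h1
            norm_num at this ⊢; linarith
          · rw [if_neg hyP]
            have : (0 : ℝ) ≤ (((64 * sZ (g y) - 32 * (u₄ y / 2) - 128 * 0) ^ 2 : ℤ) : ℝ) := by positivity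
            norm_num at this ⊢; linarith
        · rw [if_pos hMy]
          have h1 : (if y ∈ P' then (1 : ℝ) else 0) ≤ 1 := by split_ifs <;> norm_num
          nlinarith [sq_nonneg (128 * signOf (g y) - 2 * W (fun x => signOf (f x)) y - M y)]
      have hsum := sum_le_sum fun y (_ : y ∈ (univ : Finset (Fin (6 + 6) → Bool))) => hpt y
      have hindP : ∑ y, (if y ∈ P' then (1 : ℝ) else 0) = #P' := by
        rw [sum_boole]
        have : (univ.filter fun y => y ∈ P') = P' := by ext y; simp
        rw [this]
      rw [sum_sub_distrib, ← mul_sum, ← mul_sum, hindP] at hsum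
      have hP'' : (2048 : ℝ) ≤ #P' := by exact_mod_cast hP'card
      nlinarith
    · -- level-`≥ 6` partner: excluded by `tz_levelSix_window_false` (roles swapped)
      push Not at h5
      have hΦ' : forrelation g f = forrelation f g := by
        rw [Summit.QuantumAdvantage.QuantumAdvantage.Theorems.SignedCubicForrelationNotPrBPP.Negative.HalfQuad.forrelation_comm]
      exact tz_levelSix_window_false g f hg hf (fun y => u₄ y / 2 / 2) (hcase6 hO h5) (by rw [hΦ']; exact hlo) (by rw [hΦ']; exact hhi)

/-- **What a level-5 side on the open window must look like** (packaging): cubic `f, g` on 12 bits, `W_g = 32u'` with some `u'` odd,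
`57/64 < Φ < 1` ⇒ EITHER some point off the odd set has `4 ∤ u' − 2(−1)^f` (then, by `tzl5_A2_energy`, the off-hyperplane energy is `≥ 1024`),
OR some point of the odd set has `u' − 2(−1)^f ≢ σ₅ (mod 8)` (the rigid world).  Finite-slice statement, NOT summit progress. [this work] -/
theorem tzl5_window_structure (f g : (Fin (6 + 6) → Bool) → Bool) (hf : IsDegLeFun 3 f) (hg : IsDegLeFun 3 g)
    (u' : (Fin (6 + 6) → Bool) → ℤ) (hu' : ∀ x, W (fun y => signOf (g y)) x = (2 : ℝ) ^ 5 * (u' x : ℝ)) (hodd : ∃ x, Odd (u' x))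
    (hlo : (57 / 64 : ℝ) < forrelation f g) (hhi : forrelation f g < 1) :
    (∃ y, ¬ Odd (u' y) ∧ ¬ (4 : ℤ) ∣ u' y - 2 * sZ (f y)) ∨
      ∃ x, Odd (u' x) ∧ ¬ (8 : ℤ) ∣ u' x - 2 * sZ (f x) - sZ (decide ((u' x - 2 * sZ (f x)) % 4 = 3)) := by
  by_contra h
  push Not at h
  exact tzl5_generic_window_false f g hf hg u' hu' hodd hlo hhi (fun y hy => h.1 y hy) (fun x hx => h.2 x hx)

/-- **The shape of a side on the open window after gen 27** (packaging): cubic `f, g` on 12 bits with `57/64 < Φ(f,g) < 1`.  Then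
`W_g = 16u` with EITHER every `u(x)` odd (type O), OR `u = 2u'` with `u'` odd somewhere (level 5, not level `≥ 6`) and the level-5 residual
`e₅ = u' − 2(−1)^f` is NOT generic: some point off the odd set has `4 ∤ e₅`, or some point of the odd set has `e₅ ≢ σ₅ (mod 8)`.  (By symmetry of
`Φ` the same holds for `f`.)  Finite-slice statement, NOT summit progress. [this work] -/
theorem tz27_window_side_shape (f g : (Fin (6 + 6) → Bool) → Bool) (hf : IsDegLeFun 3 f) (hg : IsDegLeFun 3 g)
    (hlo : (57 / 64 : ℝ) < forrelation f g) (hhi : forrelation f g < 1) :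
    ∃ u : (Fin (6 + 6) → Bool) → ℤ, (∀ x, W (fun y => signOf (g y)) x = (2 : ℝ) ^ 4 * (u x : ℝ)) ∧
      ((∀ x, Odd (u x)) ∨
       ((∀ x, W (fun y => signOf (g y)) x = (2 : ℝ) ^ 5 * (((u x / 2 : ℤ)) : ℝ)) ∧ (∃ x, Odd (u x / 2)) ∧
        ((∃ y, ¬ Odd (u y / 2) ∧ ¬ (4 : ℤ) ∣ u y / 2 - 2 * sZ (f y)) ∨
          ∃ x, Odd (u x / 2) ∧ ¬ (8 : ℤ) ∣ u x / 2 - 2 * sZ (f x) - sZ (decide ((u x / 2 - 2 * sZ (f x)) % 4 = 3))))) := by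
  obtain ⟨u, hu⟩ := tw_base (n := 6 + 6) g hg 4 (by norm_num)
  refine ⟨u, hu, ?_⟩
  by_cases hO : ∃ x, Odd (u x)
  · exact Or.inl (TypeOTwelve.typeO_of_exists_odd g u hg hu hO)
  right
  push Not at hO
  have hu5 : ∀ x, W (fun y => signOf (g y)) x = (2 : ℝ) ^ 5 * (((u x / 2 : ℤ)) : ℝ) :=
    fun x => (tw_level_up (j := 4) g u hu hO x).trans (by norm_num)
  have h5 : ∃ x, Odd (u x / 2) := by
    by_contra hnone
    push Not at hnone
    have hu6 : ∀ x, W (fun y => signOf (g y)) x = (2 : ℝ) ^ 6 * (((u x / 2 / 2 : ℤ)) : ℝ) :=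
      fun x => (tw_level_up (j := 5) g (fun x => u x / 2) hu5 hnone x).trans (by norm_num)
    exact tz_levelSix_window_false f g hf hg (fun x => u x / 2 / 2) hu6 hlo hhi
  exact ⟨hu5, h5, tzl5_window_structure f g hf hg (fun x => u x / 2) hu5 h5 hlo hhi⟩

end Summit.QuantumAdvantage.QuantumAdvantage.Theorems.CubicForrelation.NearExactIsExact

end
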